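import Literature.Computability.AlgebraicComplexity.BDI20TableauTreewidthLowerBound
import Literature.Combinatorics.SimpleGraph.TreewidthBrambleLowerBound
import HarnessLib

/-!
# Bläser–Dörfler–Ikenmeyer 2020/2021, Prop 7.5 (2) holds: two-row tableau graphs of
# tree-width `Ω(√n)` (theorem-only file)

Cell `val-lit`, seat x6 (gen 5). DISCHARGES `BDI2020_prop_7_5_lower`
(`BDI20TableauTreewidthLowerBound.lean`; BDI CCC 2021 Prop 7.5 (2) = arXiv:2002.11594
Prop 20 (2)) with the explicit constant `C = 3`: `BDI2020_prop_7_5_lower_holds`, FOLLOWING THE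
PRINTED PROOF (arXiv p0016.txt:L32-66) with the tree's names: the witnesses are the printed
tableaux `S'_n` = `BDI20Treewidth.gridTableau (2k) n` (diagonal-layered doubled `2k × 2k` grid,
`k = ⌊⌊√n⌋/2⌋`, padded by single boxes); this file proves

* A. the diagonal labelling `gridLabel` is a bijection of the grid onto `{0, …, m²-1}`, strictly
  monotone in the diagonal-lexicographic order (`gridLabel_lt_of_diagLT`, `exists_gridLabel_eq`);
* B. the column list is sorted in both rows ("the edges between two layers are not crossing,
  there is a unique ordering on the set of edges from left to right … forms exactly the wanted
  semistandard tableaux": `pairwise_gridEdges`, `isSemistandard_gridTableau`) and has partition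
  shape with columns of height `≤ 2`;
* C. content `n × 4`: "doubling all the edges … results in each vertex having degree exactly
  `4`" (`gridCols_count`: out-degree + in-degree of the doubled grid, a case analysis on the
  boundary and the parities) and four single boxes per padding label (`pad_count`);
  `isTableauOfContent_gridTableau`;
* D. the `2k × 2k` grid embeds into `G_{S'_n}` (`treewidth_grid_le_tableauGraph`), so
  `tw(G_{S'_n}) ≥ 2k - 1` by the crosses bramble
  (`Literature.Combinatorics.SimpleGraph.min_le_treewidth_grid`,
  `treewidth_le_of_hom_injective`; the print quotes "treewidth exactly `2k`
  [cygan2015parameterized]" — the weaker `≥ 2k - 1` proved in the tree suffices for `Ω(√n)`),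
  and `⌊√n⌋ ≤ 2k + 1 ≤ 3 (2k - 1)`.

Theorem-only, sorry-free, no new facts; helpers private. `VP ≠ VNP` is NOT proved and nothing
here bears on it.

## References
* [BlaserDorflerIkenmeyer2020] arXiv:2002.11594 Prop 20 (2) and its proof, p0016.txt:L24-25,
  L32-66 (= CCC 2021 LIPIcs 200:29 Prop 7.5 (2)).
* Tree: `Literature/Combinatorics/SimpleGraph/TreewidthBrambleLowerBound.lean` (brambles,
  grid, monotonicity; Diestel 2010 Lemma 12.3.1 / Thm 12.3.6, Bondy–Murty §10.5).
-/

noncomputable section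

open scoped Classical

namespace Literature.Computability.AlgebraicComplexity

namespace BDI20Treewidth

open Literature.Combinatorics.SimpleGraph _root_.SimpleGraph

variable {m : ℕ}

/-! ### The diagonal order and the labels -/

/-- Membership in the grid vertex set. [folklore] -/
private theorem mem_gridVerts {p : ℕ × ℕ} : p ∈ gridVerts m ↔ p.1 < m ∧ p.2 < m := by
  simp [gridVerts, Finset.mem_product]

/-- The grid has `m²` vertices. [folklore] -/
private theorem card_gridVerts : (gridVerts m).card = m * m := by
  simp [gridVerts]

/-- The diagonal order is irreflexive. [folklore] -/
private theorem diagLT_irrefl (p : ℕ × ℕ) : ¬ DiagLT p p := by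
  unfold DiagLT; omega

/-- The diagonal order is transitive. [folklore] -/
private theorem diagLT_trans {p q r : ℕ × ℕ} (h₁ : DiagLT p q) (h₂ : DiagLT q r) : DiagLT p r := by
  unfold DiagLT at *; omega

/-- The diagonal order is asymmetric. [folklore] -/
private theorem diagLT_asymm {p q : ℕ × ℕ} (h : DiagLT p q) : ¬ DiagLT q p := by
  unfold DiagLT at *; omega

/-- The diagonal order is trichotomous. [folklore] -/
private theorem diagLT_trichotomy (p q : ℕ × ℕ) : DiagLT p q ∨ p = q ∨ DiagLT q p := by
  obtain ⟨x, y⟩ := p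
  obtain ⟨x', y'⟩ := q
  unfold DiagLT
  simp only [Prod.mk.injEq]
  omega

/-- The labelling is strictly monotone in the diagonal order. [folklore] -/
private theorem gridLabel_lt_of_diagLT {p q : ℕ × ℕ} (hp : p ∈ gridVerts m) (h : DiagLT p q) :
    gridLabel m p < gridLabel m q := by
  unfold gridLabel
  refine Finset.card_lt_card ⟨fun r hr => ?_, fun hsub => ?_⟩
  · rw [Finset.mem_filter] at hr ⊢
    exact ⟨hr.1, diagLT_trans hr.2 h⟩
  · have := hsub (Finset.mem_filter.2 ⟨hp, h⟩)
    exact diagLT_irrefl p (Finset.mem_filter.1 this).2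

/-- The labelling is weakly monotone in the diagonal order. [folklore] -/
private theorem gridLabel_le_of {p q : ℕ × ℕ} (hp : p ∈ gridVerts m) (h : DiagLT p q ∨ p = q) :
    gridLabel m p ≤ gridLabel m q := by
  rcases h with h | rfl
  · exact (gridLabel_lt_of_diagLT hp h).le
  · exact le_rfl

/-- Labels are `< m²`. [folklore] -/
private theorem gridLabel_lt_sq {p : ℕ × ℕ} (hp : p ∈ gridVerts m) : gridLabel m p < m * m := by
  unfold gridLabel
  rw [← card_gridVerts (m := m)]
  refine Finset.card_lt_card ⟨Finset.filter_subset _ _, fun hsub => ?_⟩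
  exact diagLT_irrefl p (Finset.mem_filter.1 (hsub hp)).2

/-- The labelling is injective on the grid. [folklore] -/
private theorem gridLabel_injOn : Set.InjOn (gridLabel m) (gridVerts m : Set (ℕ × ℕ)) := by
  intro p hp q hq h
  rcases diagLT_trichotomy p q with hlt | heq | hgt
  · exact absurd h (gridLabel_lt_of_diagLT (Finset.mem_coe.1 hp) hlt).ne
  · exact heq
  · exact absurd h (gridLabel_lt_of_diagLT (Finset.mem_coe.1 hq) hgt).ne'

/-- Two grid points have the same label iff they are equal. [folklore] -/
private theorem gridLabel_eq_iff {p q : ℕ × ℕ} (hp : p ∈ gridVerts m) (hq : q ∈ gridVerts m) :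
    gridLabel m p = gridLabel m q ↔ p = q :=
  ⟨fun h => gridLabel_injOn (Finset.mem_coe.2 hp) (Finset.mem_coe.2 hq) h, fun h => h ▸ rfl⟩

/-- The labelling is onto `{0, …, m²-1}`. [folklore] -/
private theorem exists_gridLabel_eq {u : ℕ} (hu : u < m * m) : ∃ p ∈ gridVerts m, gridLabel m p = u := by
  have himg : (gridVerts m).image (gridLabel m) = Finset.range (m * m) := by
    refine Finset.eq_of_subset_of_card_le (fun v hv => ?_) ?_
    · obtain ⟨p, hp, rfl⟩ := Finset.mem_image.1 hv
      exact Finset.mem_range.2 (gridLabel_lt_sq hp)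
    · rw [Finset.card_range, Finset.card_image_of_injOn gridLabel_injOn, card_gridVerts]
  have : u ∈ (gridVerts m).image (gridLabel m) := by rw [himg]; exact Finset.mem_range.2 hu
  simpa using this

/-! ### The vertex list -/

/-- The vertex list lists exactly the grid points. [folklore] -/
private theorem mem_gridVertList {p : ℕ × ℕ} : p ∈ gridVertList m ↔ p ∈ gridVerts m := by
  rw [mem_gridVerts]
  simp only [gridVertList, List.mem_flatMap, List.mem_range, List.mem_map, List.mem_filter,
    decide_eq_true_eq]
  constructor
  · rintro ⟨d, hd, x, ⟨hx, hxd, hdx⟩, rfl⟩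
    exact ⟨hx, hdx⟩
  · rintro ⟨h1, h2⟩
    exact ⟨p.1 + p.2, by omega, p.1, ⟨h1, by omega, by omega⟩, Prod.ext rfl (by simp)⟩

/-- The vertex list has no duplicates. [folklore] -/
private theorem nodup_gridVertList : (gridVertList m).Nodup := by
  unfold gridVertList
  rw [List.nodup_flatMap]
  constructor
  · intro d _
    refine (List.Nodup.filter _ List.nodup_range).map_on ?_
    intro x _ y _ h
    exact (Prod.mk.inj h).1
  · refine List.Pairwise.imp_of_mem ?_ List.pairwise_lt_range
    intro d d' hd hd' hlt
    simp only [Function.onFun, List.disjoint_left, List.mem_map, List.mem_filter, List.mem_range,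
      decide_eq_true_eq]
    rintro p ⟨x, ⟨-, hxd, -⟩, rfl⟩ ⟨x', ⟨-, hxd', -⟩, h⟩
    simp only [Prod.mk.injEq] at h
    omega

/-- The vertex list is sorted in the diagonal order. [folklore] -/
private theorem pairwise_gridVertList : (gridVertList m).Pairwise DiagLT := by
  unfold gridVertList
  rw [List.pairwise_flatMap]
  constructor
  · intro d _
    rw [List.pairwise_map]
    refine List.Pairwise.imp_of_mem ?_ ((List.pairwise_lt_range).filter _)
    intro x x' hx hx' hlt
    rw [List.mem_filter, decide_eq_true_eq] at hx hx'
    unfold DiagLT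
    simp only
    omega
  · refine List.Pairwise.imp_of_mem ?_ List.pairwise_lt_range
    intro d d' _ _ hlt p hp q hq
    simp only [List.mem_map, List.mem_filter, List.mem_range, decide_eq_true_eq] at hp hq
    obtain ⟨x, ⟨-, hxd, -⟩, rfl⟩ := hp
    obtain ⟨x', ⟨-, hxd', -⟩, rfl⟩ := hq
    unfold DiagLT
    simp only
    omega

/-! ### The edges -/

/-- Edge multiplicities are at least one. [folklore] -/
private theorem one_le_upMult (p : ℕ × ℕ) : 1 ≤ upMult m p := by
  unfold upMult; split_ifs <;> omega

/-- Edge multiplicities are at least one. [folklore] -/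
private theorem one_le_rightMult (p : ℕ × ℕ) : 1 ≤ rightMult m p := by
  unfold rightMult; split_ifs <;> omega

/-- Membership in the out-edge list of a grid point. [folklore] -/
private theorem mem_gridOutEdges {p : ℕ × ℕ} {e : (ℕ × ℕ) × (ℕ × ℕ)} :
    e ∈ gridOutEdges m p ↔
      (p.2 + 1 < m ∧ e = (p, (p.1, p.2 + 1))) ∨ (p.1 + 1 < m ∧ e = (p, (p.1 + 1, p.2))) := by
  have h1 := one_le_upMult (m := m) p
  have h2 := one_le_rightMult (m := m) p
  unfold gridOutEdges
  rw [List.mem_append]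
  constructor
  · rintro (h | h)
    · split_ifs at h with hc
      · rw [List.mem_replicate] at h; exact Or.inl ⟨hc, h.2⟩
      · simp at h
    · split_ifs at h with hc
      · rw [List.mem_replicate] at h; exact Or.inr ⟨hc, h.2⟩
      · simp at h
  · rintro (⟨hc, rfl⟩ | ⟨hc, rfl⟩)
    · left; rw [if_pos hc, List.mem_replicate]; exact ⟨by omega, rfl⟩
    · right; rw [if_pos hc, List.mem_replicate]; exact ⟨by omega, rfl⟩

/-- Membership in the edge list. [folklore] -/
private theorem mem_gridEdges {e : (ℕ × ℕ) × (ℕ × ℕ)} :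
    e ∈ gridEdges m ↔ e.1 ∈ gridVerts m ∧ e ∈ gridOutEdges m e.1 := by
  unfold gridEdges
  rw [List.mem_flatMap]
  constructor
  · rintro ⟨p, hp, he⟩
    have : e.1 = p := by
      rcases mem_gridOutEdges.1 he with ⟨-, rfl⟩ | ⟨-, rfl⟩ <;> rfl
    subst this
    exact ⟨mem_gridVertList.1 hp, he⟩
  · rintro ⟨h1, h2⟩
    exact ⟨e.1, mem_gridVertList.2 h1, h2⟩

/-- An out-edge of a grid point has that point as tail and, as head, a grid point on the next diagonal with `x`-coordinate that of the tail or one more. [folklore] -/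
private theorem outEdge_facts {p : ℕ × ℕ} {e : (ℕ × ℕ) × (ℕ × ℕ)} (hp : p ∈ gridVerts m)
    (he : e ∈ gridOutEdges m p) :
    e.1 = p ∧ e.2 ∈ gridVerts m ∧ e.2.1 + e.2.2 = p.1 + p.2 + 1 ∧
      (e.2.1 = p.1 ∨ e.2.1 = p.1 + 1) ∧ DiagLT p e.2 := by
  have hp' := mem_gridVerts.1 hp
  rcases mem_gridOutEdges.1 he with ⟨hc, rfl⟩ | ⟨hc, rfl⟩
  · refine ⟨rfl, mem_gridVerts.2 ⟨hp'.1, hc⟩, by simp; omega, Or.inl rfl, ?_⟩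
    unfold DiagLT; simp
  · refine ⟨rfl, mem_gridVerts.2 ⟨hc, hp'.2⟩, by simp; omega, Or.inr rfl, ?_⟩
    unfold DiagLT; simp

/-- Tail and head of an edge are grid points, the head on the next diagonal with `x`-coordinate that of the tail or one more. [folklore] -/
private theorem gridEdge_facts {e : (ℕ × ℕ) × (ℕ × ℕ)} (he : e ∈ gridEdges m) :
    e.1 ∈ gridVerts m ∧ e.2 ∈ gridVerts m ∧ e.2.1 + e.2.2 = e.1.1 + e.1.2 + 1 ∧
      (e.2.1 = e.1.1 ∨ e.2.1 = e.1.1 + 1) ∧ DiagLT e.1 e.2 := by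
  obtain ⟨h1, h2⟩ := mem_gridEdges.1 he
  obtain ⟨-, h⟩ := outEdge_facts h1 h2
  exact ⟨h1, h⟩

/-! ### Semistandardness and shape -/

/-- The edge list is sorted: tails and heads both weakly increase in label (edges between consecutive layers do not cross). [folklore] -/
private theorem pairwise_gridEdges :
    (gridEdges m).Pairwise (fun e e' => gridLabel m e.1 ≤ gridLabel m e'.1 ∧
      gridLabel m e.2 ≤ gridLabel m e'.2) := by
  unfold gridEdges
  rw [List.pairwise_flatMap]
  constructor
  · -- inside the out-edges of one vertex
    intro p hp
    have hpV := mem_gridVertList.1 hp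
    have hpV' := mem_gridVerts.1 hpV
    unfold gridOutEdges
    rw [List.pairwise_append]
    refine ⟨?_, ?_, ?_⟩
    · split_ifs
      · exact List.pairwise_replicate.2 (Or.inr ⟨le_rfl, le_rfl⟩)
      · exact List.Pairwise.nil
    · split_ifs
      · exact List.pairwise_replicate.2 (Or.inr ⟨le_rfl, le_rfl⟩)
      · exact List.Pairwise.nil
    · intro e he e' he'
      split_ifs at he he' with hc hc'
      · rw [List.mem_replicate] at he he'
        rw [he.2, he'.2]
        refine ⟨le_rfl, gridLabel_le_of (mem_gridVerts.2 ⟨hpV'.1, hc⟩) (Or.inl ?_)⟩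
        unfold DiagLT; simp only; omega
      all_goals simp at he he'
  · -- across vertices `p` before `q`
    refine List.Pairwise.imp_of_mem ?_ pairwise_gridVertList
    intro p q hp hq hlt e he e' he'
    have hpV := mem_gridVertList.1 hp
    have hqV := mem_gridVertList.1 hq
    obtain ⟨hte, h2, h3, h4, -⟩ := outEdge_facts hpV he
    obtain ⟨hte', h2', h3', h4', -⟩ := outEdge_facts hqV he'
    rw [hte, hte']
    refine ⟨(gridLabel_lt_of_diagLT hpV hlt).le, gridLabel_le_of h2 ?_⟩
    rcases diagLT_trichotomy e.2 e'.2 with h | h | h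
    · exact Or.inl h
    · exact Or.inr h
    · exfalso
      unfold DiagLT at hlt h
      omega

/-- The row condition of semistandardness holds for all pairs of columns of the grid tableau. [folklore] -/
private theorem pairwise_gridTableau {n : ℕ} :
    (gridTableau m n).Pairwise (fun c c' => ∀ i, i < c'.length → c.getD i 0 ≤ c'.getD i 0) := by
  unfold gridTableau
  rw [List.pairwise_append]
  refine ⟨?_, ?_, ?_⟩
  · rw [List.pairwise_map]
    refine pairwise_gridEdges.imp fun {e e'} h => ?_
    intro i hi
    simp only [List.length_cons, List.length_nil] at hi
    interval_cases i <;> simp [h.1, h.2]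
  · rw [List.pairwise_flatMap]
    constructor
    · intro i _
      exact List.pairwise_replicate.2 (Or.inr fun j _ => le_rfl)
    · refine List.Pairwise.imp_of_mem ?_ List.pairwise_lt_range
      intro i i' _ _ hlt c hc c' hc'
      rw [List.mem_replicate] at hc hc'
      rw [hc.2, hc'.2]
      intro j hj
      simp only [List.length_cons, List.length_nil] at hj
      interval_cases j; simp; omega
  · intro c hc c' hc'
    rw [List.mem_map] at hc
    obtain ⟨e, he, rfl⟩ := hc
    simp only [List.mem_flatMap, List.mem_range, List.mem_replicate] at hc'
    obtain ⟨i, hi, -, rfl⟩ := hc'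
    intro j hj
    simp only [List.length_cons, List.length_nil] at hj
    interval_cases j
    simp
    have := gridLabel_lt_sq (gridEdge_facts he).1
    omega

/-- **`S'_n` is semistandard**: columns strictly increase (tail label < head label) and both
rows weakly increase along the column list ("Adding columns corresponding to the edges in exactly
this order to `S` forms exactly the wanted semistandard tableaux").
[cite: BlaserDorflerIkenmeyer2020, Prop 20 (2) (proof; arXiv p0016.txt:L46-50)] -/
theorem isSemistandard_gridTableau {n : ℕ} :
    BDI2020.IsSemistandard (gridTableau m n) := by
  refine ⟨fun c hc => ?_, pairwise_gridTableau.isChain⟩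
  unfold gridTableau at hc
  rw [List.mem_append] at hc
  rcases hc with hc | hc
  · rw [List.mem_map] at hc
    obtain ⟨e, he, rfl⟩ := hc
    obtain ⟨h1, -, -, -, h5⟩ := gridEdge_facts he
    exact List.isChain_pair.2 (gridLabel_lt_of_diagLT h1 h5)
  · simp only [List.mem_flatMap, List.mem_range, List.mem_replicate] at hc
    obtain ⟨i, hi, -, rfl⟩ := hc
    exact List.isChain_singleton _

/-- Columns of the grid tableau are nonempty of height `≤ 2`. [folklore] -/
private theorem length_le_two_of_mem_gridTableau {n : ℕ} {c : List ℕ} (hc : c ∈ gridTableau m n) :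
    c.length ≤ 2 ∧ c ≠ [] := by
  unfold gridTableau at hc
  rw [List.mem_append] at hc
  rcases hc with hc | hc
  · rw [List.mem_map] at hc
    obtain ⟨e, he, rfl⟩ := hc
    simp
  · simp only [List.mem_flatMap, List.mem_range, List.mem_replicate] at hc
    obtain ⟨i, hi, -, rfl⟩ := hc
    simp

/-- Entries of the grid tableau are `< n`. [folklore] -/
private theorem lt_of_mem_gridTableau {n : ℕ} (hn : m * m ≤ n) {c : List ℕ} (hc : c ∈ gridTableau m n)
    {u : ℕ} (hu : u ∈ c) : u < n := by
  unfold gridTableau at hc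
  rw [List.mem_append] at hc
  rcases hc with hc | hc
  · rw [List.mem_map] at hc
    obtain ⟨e, he, rfl⟩ := hc
    obtain ⟨h1, h2, -⟩ := gridEdge_facts he
    simp only [List.mem_cons, List.not_mem_nil, or_false] at hu
    rcases hu with rfl | rfl
    · exact lt_of_lt_of_le (gridLabel_lt_sq h1) hn
    · exact lt_of_lt_of_le (gridLabel_lt_sq h2) hn
  · simp only [List.mem_flatMap, List.mem_range, List.mem_replicate] at hc
    obtain ⟨i, hi, -, rfl⟩ := hc
    simp only [List.mem_singleton] at hu
    omega

/-- The trivial relation holds pairwise. [folklore] -/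
private theorem pairwise_true {α : Type*} (l : List α) : l.Pairwise (fun _ _ => True) := by
  induction l with
  | nil => exact List.Pairwise.nil
  | cons a l ih => exact List.pairwise_cons.2 ⟨fun _ _ => trivial, ih⟩

/-- The grid tableau has partition shape: column heights weakly decrease. [folklore] -/
private theorem pairwise_length_gridTableau {n : ℕ} :
    (gridTableau m n).Pairwise (fun c c' => c'.length ≤ c.length) := by
  unfold gridTableau
  rw [List.pairwise_append]
  refine ⟨?_, ?_, ?_⟩
  · rw [List.pairwise_map]
    exact (pairwise_true _).imp fun _ => by simp
  · rw [List.pairwise_flatMap]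
    constructor
    · intro i _
      exact List.pairwise_replicate.2 (Or.inr le_rfl)
    · exact (pairwise_true _).imp_of_mem fun _ _ _ c hc c' hc' => by
        rw [List.mem_replicate] at hc hc'
        rw [hc.2, hc'.2]; simp
  · intro c hc c' hc'
    rw [List.mem_map] at hc
    obtain ⟨e, he, rfl⟩ := hc
    simp only [List.mem_flatMap, List.mem_range, List.mem_replicate] at hc'
    obtain ⟨i, hi, -, rfl⟩ := hc'
    simp

/-! ### Content: every label occurs exactly four times -/

/-- Counting in a two-box column. [folklore] -/
private theorem count_pair (u a b : ℕ) :
    List.count u [a, b] = (if a = u then 1 else 0) + (if b = u then 1 else 0) := by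
  rw [List.count_cons, List.count_cons, List.count_nil]
  simp only [beq_iff_eq]
  split_ifs <;> omega

/-- Counting in a single box. [folklore] -/
private theorem count_single (u a : ℕ) : List.count u [a] = if a = u then 1 else 0 := by
  rw [List.count_cons, List.count_nil]
  simp only [beq_iff_eq]
  split_ifs <;> omega

/-- Sums over a `flatMap` split along the outer list. [folklore] -/
private theorem sum_map_flatMap {α β : Type*} (l : List α) (f : α → List β) (g : β → ℕ) :
    ((l.flatMap f).map g).sum = (l.map fun a => ((f a).map g).sum).sum := by
  induction l with
  | nil => simp
  | cons a l ih => simp [List.flatMap_cons, List.sum_append, ih]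

/-- The number of occurrences of the label of a grid point in the grid columns, as a sum of local contributions over the vertex list. [folklore] -/
private theorem gridCols_count_eq {p : ℕ × ℕ} (hp : p ∈ gridVerts m) :
    (((gridEdges m).map fun e => [gridLabel m e.1, gridLabel m e.2]).map
        (List.count (gridLabel m p))).sum =
      ((gridVertList m).map fun q => ((gridOutEdges m q).map fun e =>
        (if e.1 = p then 1 else 0) + (if e.2 = p then 1 else 0)).sum).sum := by
  unfold gridEdges
  rw [List.map_map, sum_map_flatMap]
  congr 1
  refine List.map_congr_left fun q hq => ?_
  congr 1
  refine List.map_congr_left fun e he => ?_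
  have hqV := mem_gridVertList.1 hq
  obtain ⟨h1, h2, -⟩ := outEdge_facts hqV he
  simp only [Function.comp, count_pair, gridLabel_eq_iff (h1 ▸ hqV) hp, gridLabel_eq_iff h2 hp]

/-- The local contribution of a vertex `q` to the count of `p`: the out-edges of `p` itself and the edges of `q` heading to `p`. [folklore] -/
private theorem local_count_eq {p q : ℕ × ℕ} :
    ((gridOutEdges m q).map fun e => (if e.1 = p then 1 else 0) + (if e.2 = p then 1 else 0)).sum =
      (if q = p then (if q.2 + 1 < m then upMult m q else 0) + (if q.1 + 1 < m then rightMult m q else 0)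
        else 0) +
      ((if q.2 + 1 < m ∧ (q.1, q.2 + 1) = p then upMult m q else 0) +
        (if q.1 + 1 < m ∧ (q.1 + 1, q.2) = p then rightMult m q else 0)) := by
  unfold gridOutEdges
  rw [List.map_append, List.sum_append]
  have hne1 : (q.1, q.2 + 1) ≠ q := fun h => by have := congrArg Prod.snd h; simp at this
  have hne2 : (q.1 + 1, q.2) ≠ q := fun h => by have := congrArg Prod.fst h; simp at this
  by_cases hq : q = p
  · subst hq
    simp only [if_true]
    split_ifs with h1 h2 h3 h4 h5 <;> simp_all [List.map_replicate, List.sum_replicate]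
  · simp only [if_neg hq]
    split_ifs with h1 h2 h3 h4 h5 <;> simp_all [List.map_replicate, List.sum_replicate]

/-- The vertex list as a finset is the grid. [folklore] -/
private theorem toFinset_gridVertList : (gridVertList m).toFinset = gridVerts m := by
  ext p; rw [List.mem_toFinset, mem_gridVertList]

/-- The vertical edges heading to `p` come from `(x, y-1)`. [folklore] -/
private theorem sum_up_into {p : ℕ × ℕ} (hp : p ∈ gridVerts m) :
    ((gridVerts m).sum fun q => if q.2 + 1 < m ∧ (q.1, q.2 + 1) = p then upMult m q else 0) =
      if 1 ≤ p.2 then upMult m (p.1, p.2 - 1) else 0 := by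
  have hp' := mem_gridVerts.1 hp
  split_ifs with hy
  · rw [Finset.sum_eq_single_of_mem (p.1, p.2 - 1) (mem_gridVerts.2 ⟨hp'.1, by omega⟩)]
    · rw [if_pos]
      refine ⟨by simp; omega, Prod.ext rfl (by simp; omega)⟩
    · intro q _ hq
      rw [if_neg]
      rintro ⟨-, h⟩
      apply hq
      rw [← h]
      simp
  · refine Finset.sum_eq_zero fun q _ => ?_
    rw [if_neg]
    rintro ⟨-, h⟩
    have := congrArg Prod.snd h
    simp at this
    omega

/-- The horizontal edges heading to `p` come from `(x-1, y)`. [folklore] -/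
private theorem sum_right_into {p : ℕ × ℕ} (hp : p ∈ gridVerts m) :
    ((gridVerts m).sum fun q => if q.1 + 1 < m ∧ (q.1 + 1, q.2) = p then rightMult m q else 0) =
      if 1 ≤ p.1 then rightMult m (p.1 - 1, p.2) else 0 := by
  have hp' := mem_gridVerts.1 hp
  split_ifs with hx
  · rw [Finset.sum_eq_single_of_mem (p.1 - 1, p.2) (mem_gridVerts.2 ⟨by omega, hp'.2⟩)]
    · rw [if_pos]
      refine ⟨by simp; omega, Prod.ext (by simp; omega) rfl⟩
    · intro q _ hq
      rw [if_neg]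
      rintro ⟨-, h⟩
      apply hq
      rw [← h]
      simp
  · refine Finset.sum_eq_zero fun q _ => ?_
    rw [if_neg]
    rintro ⟨-, h⟩
    have := congrArg Prod.fst h
    simp at this
    omega

/-- Every grid label occurs exactly four times in the grid columns: the doubled `2k × 2k` grid is `4`-regular (case analysis on the boundary and the parities). [folklore] -/
private theorem gridCols_count {k : ℕ} (hm : m = 2 * k) {p : ℕ × ℕ} (hp : p ∈ gridVerts m) :
    (((gridEdges m).map fun e => [gridLabel m e.1, gridLabel m e.2]).map
        (List.count (gridLabel m p))).sum = 4 := by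
  rw [gridCols_count_eq hp]
  simp only [local_count_eq]
  rw [← List.sum_toFinset _ nodup_gridVertList, toFinset_gridVertList, Finset.sum_add_distrib,
    Finset.sum_add_distrib, Finset.sum_ite_eq' (gridVerts m) p, if_pos hp, sum_up_into hp,
    sum_right_into hp]
  have hp' := mem_gridVerts.1 hp
  obtain ⟨x, y⟩ := p
  simp only at hp' ⊢
  unfold upMult rightMult
  simp only
  split_ifs <;> omega

/-- A label `u < m²` does not occur in the padding; a label `m² ≤ u < n` occurs there four times. [folklore] -/
private theorem pad_count {n u : ℕ} :
    (((List.range (n - m * m)).flatMap fun i => List.replicate 4 [m * m + i]).map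
        (List.count u)).sum = if m * m ≤ u ∧ u < n then 4 else 0 := by
  rw [sum_map_flatMap]
  simp only [List.map_replicate, List.sum_replicate, count_single, smul_eq_mul]
  rw [← List.sum_toFinset _ List.nodup_range, List.toFinset_range]
  split_ifs with hu
  · rw [Finset.sum_eq_single_of_mem (u - m * m) (Finset.mem_range.2 (by omega))]
    · rw [if_pos (by omega)]
    · intro i _ hi
      rw [if_neg (by omega), mul_zero]
  · refine Finset.sum_eq_zero fun i hi => ?_
    rw [Finset.mem_range] at hi
    rw [if_neg (by omega), mul_zero]

/-- A label `≥ m²` does not occur in the grid columns. [folklore] -/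
private theorem gridCols_count_eq_zero {u : ℕ} (hu : m * m ≤ u) :
    (((gridEdges m).map fun e => [gridLabel m e.1, gridLabel m e.2]).map (List.count u)).sum = 0 := by
  refine List.sum_eq_zero fun c hc => ?_
  rw [List.map_map, List.mem_map] at hc
  obtain ⟨e, he, rfl⟩ := hc
  obtain ⟨h1, h2, -⟩ := gridEdge_facts he
  have := gridLabel_lt_sq h1
  have := gridLabel_lt_sq h2
  simp only [Function.comp, count_pair]
  rw [if_neg (by omega), if_neg (by omega), add_zero]

/-- **`S'_n` has content `n × 4`** (partition shape, entries `< n`, every label exactly four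
times: "results in each vertex having degree exactly `4`" plus four single boxes per padding
label), for even side length `m = 2k` and `m² ≤ n`.
[cite: BlaserDorflerIkenmeyer2020, Prop 20 (2) (proof; arXiv p0016.txt:L32-34, L63)] -/
theorem isTableauOfContent_gridTableau {k n : ℕ} (hm : m = 2 * k)
    (hn : m * m ≤ n) : BDI2020.IsTableauOfContent (gridTableau m n) n 4 := by
  refine ⟨fun c hc => (length_le_two_of_mem_gridTableau hc).2, pairwise_length_gridTableau,
    fun c hc u hu => lt_of_mem_gridTableau hn hc hu, fun u hu => ?_⟩
  unfold gridTableau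
  rw [List.map_append, List.sum_append, pad_count]
  by_cases hum : u < m * m
  · obtain ⟨p, hp, rfl⟩ := exists_gridLabel_eq hum
    rw [gridCols_count hm hp, if_neg (by omega)]
  · rw [gridCols_count_eq_zero (by omega), if_pos ⟨by omega, hu⟩]

/-! ### The grid embeds into the graph of the grid tableau; the lower bound -/

/-- Every edge of the grid (upwards or rightwards) is a column of the grid tableau. [folklore] -/
private theorem pair_mem_gridTableau {n : ℕ} {p q : ℕ × ℕ} (hp : p ∈ gridVerts m)
    (h : (q = (p.1, p.2 + 1) ∧ p.2 + 1 < m) ∨ (q = (p.1 + 1, p.2) ∧ p.1 + 1 < m)) :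
    [gridLabel m p, gridLabel m q] ∈ gridTableau m n := by
  unfold gridTableau
  rw [List.mem_append]
  left
  rw [List.mem_map]
  refine ⟨(p, q), mem_gridEdges.2 ⟨hp, ?_⟩, rfl⟩
  rcases h with ⟨rfl, hc⟩ | ⟨rfl, hc⟩
  · exact mem_gridOutEdges.2 (Or.inl ⟨hc, rfl⟩)
  · exact mem_gridOutEdges.2 (Or.inr ⟨hc, rfl⟩)

/-- **The `(a+1) × (a+1)` grid embeds into the graph of the grid tableau** (every grid edge is a
column), hence `tw(grid) ≤ tw(G_{S'_n})`.
[cite: BlaserDorflerIkenmeyer2020, Prop 20 (2) (proof; arXiv p0016.txt:L56-66)] -/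
theorem treewidth_grid_le_tableauGraph {a n : ℕ} (hn : (a + 1) * (a + 1) ≤ n) :
    treewidth (grid a a) ≤ treewidth (BDI2020.tableauGraph (gridTableau (a + 1) n) n) := by
  have hV : ∀ v : Fin (a + 1) × Fin (a + 1), ((v.1 : ℕ), (v.2 : ℕ)) ∈ gridVerts (a + 1) :=
    fun v => mem_gridVerts.2 ⟨v.1.isLt, v.2.isLt⟩
  have hcol : ∀ {v w : Fin (a + 1) × Fin (a + 1)},
      (v.1 = w.1 ∧ (v.2 : ℕ) + 1 = w.2) ∨ (v.2 = w.2 ∧ (v.1 : ℕ) + 1 = w.1) →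
      [gridLabel (a + 1) ((v.1 : ℕ), (v.2 : ℕ)), gridLabel (a + 1) ((w.1 : ℕ), (w.2 : ℕ))] ∈
        gridTableau (a + 1) n := by
    intro v w h
    refine pair_mem_gridTableau (hV v) ?_
    rcases h with ⟨h1, h2⟩ | ⟨h1, h2⟩
    · left
      refine ⟨Prod.ext (by simp [h1]) (by simp; omega), ?_⟩
      have := w.2.isLt; simp only; omega
    · right
      refine ⟨Prod.ext (by simp; omega) (by simp [h1]), ?_⟩
      have := w.1.isLt; simp only; omega
  let f : grid a a →g BDI2020.tableauGraph (gridTableau (a + 1) n) n :=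
    { toFun := fun v => ⟨gridLabel (a + 1) ((v.1 : ℕ), (v.2 : ℕ)),
        lt_of_lt_of_le (gridLabel_lt_sq (hV v)) hn⟩
      map_rel' := by
        intro v w hvw
        rw [BDI2020.tableauGraph, SimpleGraph.fromRel_adj]
        refine ⟨fun h => ?_, ?_⟩
        · have h' := (gridLabel_eq_iff (hV v) (hV w)).1 (congrArg Fin.val h)
          simp only [Prod.mk.injEq] at h'
          exact (grid a a).ne_of_adj hvw (Prod.ext (Fin.ext h'.1) (Fin.ext h'.2))
        · rw [grid_adj] at hvw
          rcases hvw with ⟨h1, h2 | h2⟩ | ⟨h1, h2 | h2⟩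
          · exact Or.inl ⟨_, hcol (Or.inl ⟨h1, h2⟩), by simp, by simp⟩
          · exact Or.inr ⟨_, hcol (Or.inl ⟨h1.symm, h2⟩), by simp, by simp⟩
          · exact Or.inl ⟨_, hcol (Or.inr ⟨h1, h2⟩), by simp, by simp⟩
          · exact Or.inr ⟨_, hcol (Or.inr ⟨h1.symm, h2⟩), by simp, by simp⟩ }
  refine treewidth_le_of_hom_injective f fun v w h => ?_
  have h' := (gridLabel_eq_iff (hV v) (hV w)).1 (congrArg Fin.val h)
  simp only [Prod.mk.injEq] at h'
  exact Prod.ext (Fin.ext h'.1) (Fin.ext h'.2)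

end BDI20Treewidth

section LowerBound

open BDI2020 BDI20Treewidth Literature.Combinatorics.SimpleGraph

/-- **BDI Prop 7.5 (2) holds** (CCC 2021 Prop 7.5 (2) = arXiv Prop 20 (2)), with the explicit
constant `C = 3`: for every `n ≥ 4` the printed tableau `S'_n` — the diagonal-layered `2k × 2k`
grid with doubled boundary edges, `k = ⌊⌊√n⌋/2⌋`, padded by four single boxes per further label
(`BDI20Treewidth.gridTableau`) — is a two-row semistandard Young tableau of content `n × 4` whose
graph contains the `2k × 2k` grid, so that `tw ≥ 2k - 1 ≥ ⌊√n⌋ / 3` (the grid bound by the bramble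
of crosses, `min_le_treewidth_grid`, where the print quotes "treewidth exactly `2k`").
[cite: BlaserDorflerIkenmeyer2020, Prop 20 (2) (arXiv; = CCC 2021 Prop 7.5 (2))] -/
theorem BDI2020_prop_7_5_lower_holds : BDI2020_prop_7_5_lower := by
  refine ⟨3, fun n hn => ?_⟩
  have hs : 2 ≤ Nat.sqrt n := by rw [Nat.le_sqrt]; omega
  have hsq : Nat.sqrt n * Nat.sqrt n ≤ n := Nat.sqrt_le n
  obtain ⟨k, hk⟩ : ∃ k, k = Nat.sqrt n / 2 := ⟨_, rfl⟩
  have hk1 : 1 ≤ k := by omega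
  have h2k : 2 * k ≤ Nat.sqrt n := by omega
  have hle : Nat.sqrt n ≤ 2 * k + 1 := by omega
  obtain ⟨a, ha⟩ : ∃ a, a + 1 = 2 * k := ⟨2 * k - 1, by omega⟩
  have hmn : (a + 1) * (a + 1) ≤ n := by
    rw [ha]
    exact (Nat.mul_le_mul h2k h2k).trans hsq
  refine ⟨gridTableau (a + 1) n, isTableauOfContent_gridTableau (k := k) ha hmn,
    isSemistandard_gridTableau, fun c hc => (length_le_two_of_mem_gridTableau hc).1, ?_⟩
  have h1 := min_le_treewidth_grid a a
  have h2 := treewidth_grid_le_tableauGraph hmn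
  rw [min_self] at h1
  omega

end LowerBound

end Literature.Computability.AlgebraicComplexity

end
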